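import Mathlib.RingTheory.Ideal.Quotient.Operations
import Mathlib.LinearAlgebra.Basis.Basic
import Mathlib.LinearAlgebra.Quotient.Basic
import HarnessLib

/-!
# Coordinates of `k₁/(a)` over `k₀/(a)` for a free `k₀`-algebra `k₁`

Topic `Algebra/Module`; namespace `Literature.Algebra.Module`.  One definition with a body and
theorems (Mathlib-only imports; no named fact, no instance, no `sorry`).

For a commutative `k₀`-algebra `k₁` with a `k₀`-basis `b`, and `a ∈ k₀`:

* `quotCoord b a m : k₁/(a) →ₗ[k₀] k₀/(a)`, `x̄ ↦ (b.repr x m)‾` — the `m`-th coordinate modulo `a`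
  (well defined: the coordinates of `a y` are `a` times those of `y`);
* `quotCoord_mk_mul_quotientMap` — `quotCoord (x̄ · c̄) = (b.repr x m) • c̄` for `c ∈ k₀`: the
  coordinate maps see multiplication by `x ∈ k₁` on the image of `k₀/(a)` as the scalars
  `b.repr x m` (the hypothesis `hcoord` of
  `TwistedQuotient.smul_eq_zero_of_smul_semimap_eq_zero`);
* `mem_span_algebraMap_of_forall_repr_mem` — if all coordinates of `x` lie in `(a')` then
  `x ∈ (a') k₁`.

Use: descent of annihilators from `𝒪_{E'}/p^t` to `𝒪_{E₀}/p^t` (`𝒪_{E'}` free over `𝒪_{E₀}`) in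
the passage to `ℤ̄_p`-coefficients of [Scholze2015, §V.4].

## References

* N. Bourbaki, *Algèbre*, Ch. II §1 (free modules, coordinates). [folklore]
* P. Scholze, Ann. of Math. 182 (2015), §V.4. [Scholze2015]
-/

namespace Literature.Algebra.Module

variable {k₀ k₁ : Type*} [CommRing k₀] [CommRing k₁] [Algebra k₀ k₁] {M : Type*}
  (b : Module.Basis M k₀ k₁) (a : k₀)

/-- The `m`-th coordinate followed by reduction modulo `a`, on `k₁`. [folklore] -/
theorem coord_mem_of_mem_span (m : M) {x : k₁}
    (hx : x ∈ (Ideal.span ({algebraMap k₀ k₁ a} : Set k₁)).restrictScalars k₀) :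
    b.repr x m ∈ Ideal.span ({a} : Set k₀) := by
  rw [Submodule.restrictScalars_mem, Ideal.mem_span_singleton'] at hx
  obtain ⟨y, rfl⟩ := hx
  rw [Ideal.mem_span_singleton']
  refine ⟨b.repr y m, ?_⟩
  rw [mul_comm y, ← Algebra.smul_def, map_smul, Finsupp.smul_apply, smul_eq_mul, mul_comm]

/-- **The `m`-th coordinate modulo `a`: `k₁/(a) → k₀/(a)`, `x̄ ↦ (b.repr x m)‾`**, a `k₀`-linear
map. [folklore] -/
noncomputable def quotCoord (m : M) :
    (k₁ ⧸ Ideal.span ({algebraMap k₀ k₁ a} : Set k₁)) →ₗ[k₀] (k₀ ⧸ Ideal.span ({a} : Set k₀)) :=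
  ((Ideal.span ({algebraMap k₀ k₁ a} : Set k₁)).restrictScalars k₀).liftQ
      ((Submodule.mkQ (Ideal.span ({a} : Set k₀))).comp (b.coord m))
      (fun x hx => by
        rw [LinearMap.mem_ker, LinearMap.comp_apply, Submodule.mkQ_apply,
          Submodule.Quotient.mk_eq_zero]
        exact coord_mem_of_mem_span b a m hx) ∘ₗ
    (Submodule.Quotient.restrictScalarsEquiv k₀ (Ideal.span ({algebraMap k₀ k₁ a} : Set k₁))).symm.toLinearMap

/-- **`quotCoord (x̄) = (b.repr x m)‾`.** [folklore] -/
@[simp]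
theorem quotCoord_mk (m : M) (x : k₁) :
    quotCoord b a m (Ideal.Quotient.mk _ x) = Ideal.Quotient.mk _ (b.repr x m) :=
  rfl

/-- **The coordinates of `x̄ · c̄` (`c ∈ k₀`) are `(b.repr x m) • c̄`.** [folklore] -/
theorem quotCoord_mk_mul_quotientMap (m : M) (x : k₁) (c : k₀) :
    quotCoord b a m (Ideal.Quotient.mk _ x * Ideal.Quotient.mk _ (algebraMap k₀ k₁ c)) =
      b.repr x m • Ideal.Quotient.mk (Ideal.span ({a} : Set k₀)) c := by
  rw [← map_mul, quotCoord_mk, mul_comm x, ← Algebra.smul_def, map_smul, Finsupp.smul_apply,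
    smul_eq_mul, mul_comm]
  exact Submodule.Quotient.mk_smul _ (b.repr x m) c

/-- The same with the scalar action of `k₁` on `k₁/(a)`: `quotCoord (x • ȳ)` for `ȳ` the image of
`c ∈ k₀`. [folklore] -/
theorem quotCoord_smul_mk_algebraMap (m : M) (x : k₁) (c : k₀) :
    quotCoord b a m (x • Ideal.Quotient.mk _ (algebraMap k₀ k₁ c)) =
      b.repr x m • Ideal.Quotient.mk (Ideal.span ({a} : Set k₀)) c := by
  rw [← quotCoord_mk_mul_quotientMap b a m x c, ← smul_eq_mul]
  rfl

/-- **Reconstruction from coordinates**: if every coordinate of `x` lies in `(a')`, then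
`x ∈ (a') k₁`. [folklore] -/
theorem mem_span_algebraMap_of_forall_repr_mem (a' : k₀) (x : k₁)
    (h : ∀ m, b.repr x m ∈ Ideal.span ({a'} : Set k₀)) :
    x ∈ Ideal.span ({algebraMap k₀ k₁ a'} : Set k₁) := by
  rw [← b.linearCombination_repr x, Finsupp.linearCombination_apply, Finsupp.sum]
  refine Submodule.sum_mem _ fun m _ => ?_
  obtain ⟨c, hc⟩ := Ideal.mem_span_singleton'.1 (h m)
  rw [← hc, mul_comm c, ← smul_smul, Algebra.smul_def a']
  exact Ideal.mul_mem_right _ _ (Ideal.subset_span rfl)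

end Literature.Algebra.Module
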